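import Summits.Ventures.CertifiedArithmetic.Expansions.Orient2dStageCBounds
import Mathlib.Tactic.Linarith
import Mathlib.Tactic.Positivity
import Mathlib.Tactic.Ring
import Mathlib.Tactic.NormNum

/-!
# ORIENT3D, stage C, part 1: the correction terms and the Taylor remainder

Shared numerical engines serving client cells; rigour lives in the verifiers; every published number
belongs to a client cell's ledger, not to the engines group. NEW WORK in the sense of this
development: the algorithm and its constants are Shewchuk's (`predicates.c`, `orient3dadapt`; the
paper, §4.4 and Table 3, states line C `(3ε + 8ε²) ⊗ |det_B| ⊕ (26ε² + 288ε³) ⊗ permanent` without a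
derivation), the error analysis is ours, in the standard model `|a ∘ b − fl(a ∘ b)| ≤ ε|a ∘ b|` over
`ℚ` (no underflow, no overflow). We transcribe the arithmetic of stage C as hypotheses between named
rationals, one per operation; we do not hold `predicates.c` in this tree and nothing here is a claim
about the C code itself.

THE OBJECT. When stage B of `orient3dadapt` falls through, the nine coordinate differences `x = xₐ ⊖
x_d, …` are given their roundoff tails `xt` (TWO-DIFF-TAIL: `x + xt` is the exact difference, `|xt|
≤ ε|x|`), and unless all nine tails vanish stage C adds to the stage-B value `det_B` the first-order
correction, summed left to right over the three cyclic terms, `c = ⊕_z [ z ⊗ (((x₁ ⊗ y₁t) ⊕ (y₁ ⊗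
x₁t)) ⊖ ((y₂ ⊗ x₂t) ⊕ (x₂ ⊗ y₂t))) ⊕ zt ⊗ (P ⊖ Q) ]`, where `z(x₁y₁ − x₂y₂)` is the minor term of
`z` and `P = x₁ ⊗ y₁`, `Q = x₂ ⊗ y₂` are its stage-A products (term `a`: `z = z_a`, `(x₁, y₁, x₂,
y₂) = (x_b, y_c, x_c, y_b)`; cyclically for `b`, `c`).

THE RESULTS (`0 ≤ ε`; `S_z = |z|(|P| + |Q|)`, `Π = S_a + S_b + S_c`):
* `orient3dCTerm_sub_le` — one cyclic term `t` against its exact first-order value `L_z = z(x₁y₁t +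
  y₁x₁t − y₂x₂t − x₂y₂t) + zt(x₁y₁ − y₂x₂)`: `|t − L_z| ≤ (14ε² + 33ε³ + 41ε⁴ + 30ε⁵ + 12ε⁶ +
  2ε⁷)S_z`, `|t| ≤ (3ε + 15ε² + 33ε³ + … + 2ε⁷)S_z`;
* `orient3dCSum_sub_le` — the two roundings of the sum: `|c − L| ≤ (20ε² + 66ε³ + 122ε⁴ + 145ε⁵ +
  113ε⁶ + 56ε⁷ + 16ε⁸ + 2ε⁹)Π` and `|c| ≤ (1 + ε)²(3ε + 15ε² + … + 2ε⁷)Π` (`L = L_a + L_b + L_c`);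
* `orient3dCRemainder_le` — the second- and third-order Taylor remainder of one minor term: `|(z +
  zt)((x₁ + x₁t)(y₁ + y₁t) − (x₂ + x₂t)(y₂ + y₂t)) − z(x₁y₁ − x₂y₂) − L_z| ≤ (3ε² + ε³)(1 + ε)S_z`.
The coefficients are worst-case bookkeeping (every rounding charged at its largest possible
magnitude), not tight. Part 2, `Orient3dStageCBounds`, assembles them into the soundness of the
stage-C sign test for arbitrary constants under explicit margins; `Orient3dStageCMargins` evaluates
the margins.

Evidence gathered before typing (engines; not part of the verification): in the exact rational model
(round-half-even to `p` bits, `p ∈ {4, 5, 6, 8, 11}`, error-free TWO-PRODUCT / TWO-DIFF, 1 500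
random coplanar or one-ulp-perturbed quadruples per precision, ≈ 1 400 of which reach stage C with a
nonzero tail) each of the three inequalities held in every trial; the worst observed values were
`3.0ε²·S_z` for the term (proved coefficient `14ε²`), `2.1ε²·Π` for the sum (`20ε²`) and
`1.13ε²·S_z` for the remainder (`3ε²`). References: J. R. Shewchuk, Discrete Comput. Geom. 18 (1997)
305–363, §4.4 and Table 3; `predicates.c` (`orient3dadapt`) [Shewchuk1997].
-/

namespace Summit.Ventures.CertifiedArithmetic.Expansions

/-! ## Rounding bookkeeping -/

/-- One rounding step: from the standard-model fact `|a − r| ≤ u|a|` and a magnitude bound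
`|a| ≤ M`, the absolute error `u M` … -/
private theorem rnd_err {u a r M : ℚ} (hu : 0 ≤ u) (h : |a - r| ≤ u * |a|) (hM : |a| ≤ M) :
    |a - r| ≤ u * M :=
  h.trans (mul_le_mul_of_nonneg_left hM hu)

/-- … and the magnitude `(1 + u) M` of the rounded result. -/
private theorem rnd_mag {u a r M : ℚ} (hu : 0 ≤ u) (h : |a - r| ≤ u * |a|) (hM : |a| ≤ M) :
    |r| ≤ (1 + u) * M := by
  have h1 : |r| - |a| ≤ |r - a| := abs_sub_abs_le_abs_sub r a
  rw [abs_sub_comm] at h1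
  have := rnd_err hu h hM
  linarith

/-- A product with a tail: `|t| ≤ u|y|` gives `|x·t| ≤ u|x·y|`. -/
private theorem abs_mul_tail_le {u x y t : ℚ} (h : |t| ≤ u * |y|) : |x * t| ≤ u * |x * y| := by
  rw [abs_mul, abs_mul]
  have := mul_le_mul_of_nonneg_left h (abs_nonneg x)
  linarith

/-! ## One cyclic term of the stage-C correction -/

/-- **One cyclic term of the correction.**  With `z` a computed `z`-difference and `zt` its tail
(`|zt| ≤ ε|z|`), the minor's computed differences `x₁, y₁, x₂, y₂` and their tails, the stage-A
products `P = x₁ ⊗ y₁`, `Q = x₂ ⊗ y₂` (`|x₁y₁ − P| ≤ ε|P|`), and the eleven roundings of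
`t = (z ⊗ (((x₁ ⊗ y₁t) ⊕ (y₁ ⊗ x₁t)) ⊖ ((y₂ ⊗ x₂t) ⊕ (x₂ ⊗ y₂t)))) ⊕ (zt ⊗ (P ⊖ Q))`, the computed
term is within `(14ε² + 33ε³ + 41ε⁴ + 30ε⁵ + 12ε⁶ + 2ε⁷)·|z|(|P| + |Q|)` of the exact first-order
term `L_z = z(x₁y₁t + y₁x₁t − y₂x₂t − x₂y₂t) + zt(x₁y₁ − y₂x₂)`, and
`|t| ≤ (3ε + 15ε² + 33ε³ + 41ε⁴ + 30ε⁵ + 12ε⁶ + 2ε⁷)·|z|(|P| + |Q|)`. -/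
theorem orient3dCTerm_sub_le
    {u z zt x₁ x₁t y₁ y₁t x₂ x₂t y₂ y₂t P Q p₁ p₂ p₃ p₄ s₁ s₂ d m e n t : ℚ} (hu : 0 ≤ u)
    (hzt : |zt| ≤ u * |z|) (hx₁t : |x₁t| ≤ u * |x₁|) (hy₁t : |y₁t| ≤ u * |y₁|)
    (hx₂t : |x₂t| ≤ u * |x₂|) (hy₂t : |y₂t| ≤ u * |y₂|)
    (hP : |x₁ * y₁ - P| ≤ u * |P|) (hQ : |x₂ * y₂ - Q| ≤ u * |Q|)
    (hp₁ : |x₁ * y₁t - p₁| ≤ u * |x₁ * y₁t|) (hp₂ : |y₁ * x₁t - p₂| ≤ u * |y₁ * x₁t|)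
    (hp₃ : |y₂ * x₂t - p₃| ≤ u * |y₂ * x₂t|) (hp₄ : |x₂ * y₂t - p₄| ≤ u * |x₂ * y₂t|)
    (hs₁ : |(p₁ + p₂) - s₁| ≤ u * |p₁ + p₂|) (hs₂ : |(p₃ + p₄) - s₂| ≤ u * |p₃ + p₄|)
    (hd : |(s₁ - s₂) - d| ≤ u * |s₁ - s₂|) (hm : |z * d - m| ≤ u * |z * d|)
    (he : |(P - Q) - e| ≤ u * |P - Q|) (hn : |zt * e - n| ≤ u * |zt * e|)
    (ht : |(m + n) - t| ≤ u * |m + n|) :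
    |t - (z * ((x₁ * y₁t + y₁ * x₁t) - (y₂ * x₂t + x₂ * y₂t)) + zt * (x₁ * y₁ - y₂ * x₂))|
        ≤ (14 * u ^ 2 + 33 * u ^ 3 + 41 * u ^ 4 + 30 * u ^ 5 + 12 * u ^ 6 + 2 * u ^ 7)
          * (|z| * (|P| + |Q|)) ∧
      |t| ≤ (3 * u + 15 * u ^ 2 + 33 * u ^ 3 + 41 * u ^ 4 + 30 * u ^ 5 + 12 * u ^ 6 + 2 * u ^ 7)
          * (|z| * (|P| + |Q|)) := by
  have hz := abs_nonneg z
  have hP0 := abs_nonneg P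
  have hQ0 := abs_nonneg Q
  have hP' : |x₁ * y₁| ≤ (1 + u) * |P| := by linarith [abs_sub_abs_le_abs_sub (x₁ * y₁) P]
  have hQ' : |x₂ * y₂| ≤ (1 + u) * |Q| := by linarith [abs_sub_abs_le_abs_sub (x₂ * y₂) Q]
  -- the four tail products
  have b₁ : |x₁ * y₁t| ≤ u * ((1 + u) * |P|) :=
    (abs_mul_tail_le hy₁t).trans (mul_le_mul_of_nonneg_left hP' hu)
  have b₂ : |y₁ * x₁t| ≤ u * ((1 + u) * |P|) := by
    have h := abs_mul_tail_le (x := y₁) hx₁t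
    rw [mul_comm y₁ x₁] at h
    exact h.trans (mul_le_mul_of_nonneg_left hP' hu)
  have b₃ : |y₂ * x₂t| ≤ u * ((1 + u) * |Q|) := by
    have h := abs_mul_tail_le (x := y₂) hx₂t
    rw [mul_comm y₂ x₂] at h
    exact h.trans (mul_le_mul_of_nonneg_left hQ' hu)
  have b₄ : |x₂ * y₂t| ≤ u * ((1 + u) * |Q|) :=
    (abs_mul_tail_le hy₂t).trans (mul_le_mul_of_nonneg_left hQ' hu)
  have ep₁ := rnd_err hu hp₁ b₁
  have mp₁ := rnd_mag hu hp₁ b₁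
  have ep₂ := rnd_err hu hp₂ b₂
  have mp₂ := rnd_mag hu hp₂ b₂
  have ep₃ := rnd_err hu hp₃ b₃
  have mp₃ := rnd_mag hu hp₃ b₃
  have ep₄ := rnd_err hu hp₄ b₄
  have mp₄ := rnd_mag hu hp₄ b₄
  -- the two sums, the difference, the product by `z`
  have bs₁ : |p₁ + p₂| ≤ 2 * ((1 + u) * (u * ((1 + u) * |P|))) := by
    linarith [abs_add_le p₁ p₂]
  have bs₂ : |p₃ + p₄| ≤ 2 * ((1 + u) * (u * ((1 + u) * |Q|))) := by
    linarith [abs_add_le p₃ p₄]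
  have es₁ := rnd_err hu hs₁ bs₁
  have ms₁ := rnd_mag hu hs₁ bs₁
  have es₂ := rnd_err hu hs₂ bs₂
  have ms₂ := rnd_mag hu hs₂ bs₂
  have bd : |s₁ - s₂| ≤ (1 + u) * (2 * ((1 + u) * (u * ((1 + u) * |P|))))
      + (1 + u) * (2 * ((1 + u) * (u * ((1 + u) * |Q|)))) := by
    linarith [abs_sub s₁ s₂]
  have ed := rnd_err hu hd bd
  have md := rnd_mag hu hd bd
  have bm : |z * d| ≤ |z| * ((1 + u) * ((1 + u) * (2 * ((1 + u) * (u * ((1 + u) * |P|))))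
      + (1 + u) * (2 * ((1 + u) * (u * ((1 + u) * |Q|)))))) := by
    rw [abs_mul]
    exact mul_le_mul_of_nonneg_left md hz
  have em := rnd_err hu hm bm
  have mm := rnd_mag hu hm bm
  -- the `zt` part
  have be : |P - Q| ≤ |P| + |Q| := abs_sub P Q
  have ee := rnd_err hu he be
  have me := rnd_mag hu he be
  have bn : |zt * e| ≤ (u * |z|) * ((1 + u) * (|P| + |Q|)) := by
    rw [abs_mul]
    exact mul_le_mul hzt me (abs_nonneg e) (by positivity)
  have en := rnd_err hu hn bn
  have mn := rnd_mag hu hn bn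
  -- the final sum
  have bt : |m + n| ≤ (1 + u) * (|z| * ((1 + u) * ((1 + u) * (2 * ((1 + u) * (u * ((1 + u)
      * |P|)))) + (1 + u) * (2 * ((1 + u) * (u * ((1 + u) * |Q|)))))))
      + (1 + u) * ((u * |z|) * ((1 + u) * (|P| + |Q|))) := by
    linarith [abs_add_le m n]
  have et := rnd_err hu ht bt
  have mt := rnd_mag hu ht bt
  refine ⟨?_, mt.trans (le_of_eq (by ring))⟩
  -- the error decomposition
  have key : t - (z * ((x₁ * y₁t + y₁ * x₁t) - (y₂ * x₂t + x₂ * y₂t)) + zt * (x₁ * y₁ - y₂ * x₂))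
      = -((m + n) - t) - (z * d - m) - z * ((s₁ - s₂) - d)
        - z * (((p₁ + p₂) - s₁) - ((p₃ + p₄) - s₂))
        - z * ((x₁ * y₁t - p₁) + (y₁ * x₁t - p₂) - (y₂ * x₂t - p₃) - (x₂ * y₂t - p₄))
        - (zt * e - n) - zt * ((P - Q) - e) - zt * ((x₁ * y₁ - P) - (x₂ * y₂ - Q)) := by
    ring
  have q₃ : |z * ((s₁ - s₂) - d)| ≤ |z| * (u * ((1 + u) * (2 * ((1 + u) * (u * ((1 + u) * |P|))))
      + (1 + u) * (2 * ((1 + u) * (u * ((1 + u) * |Q|)))))) := by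
    rw [abs_mul]; exact mul_le_mul_of_nonneg_left ed hz
  have q₄ : |z * (((p₁ + p₂) - s₁) - ((p₃ + p₄) - s₂))| ≤ |z| * (u * (2 * ((1 + u) * (u * ((1 + u)
      * |P|)))) + u * (2 * ((1 + u) * (u * ((1 + u) * |Q|))))) := by
    rw [abs_mul]
    refine mul_le_mul_of_nonneg_left ?_ hz
    linarith [abs_sub ((p₁ + p₂) - s₁) ((p₃ + p₄) - s₂)]
  have q₅ : |z * ((x₁ * y₁t - p₁) + (y₁ * x₁t - p₂) - (y₂ * x₂t - p₃) - (x₂ * y₂t - p₄))|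
      ≤ |z| * (u * (u * ((1 + u) * |P|)) + u * (u * ((1 + u) * |P|)) + u * (u * ((1 + u) * |Q|))
        + u * (u * ((1 + u) * |Q|))) := by
    rw [abs_mul]
    refine mul_le_mul_of_nonneg_left ?_ hz
    have h1 := abs_add_le (x₁ * y₁t - p₁) (y₁ * x₁t - p₂)
    have h2 := abs_sub ((x₁ * y₁t - p₁) + (y₁ * x₁t - p₂)) (y₂ * x₂t - p₃)
    have h3 := abs_sub ((x₁ * y₁t - p₁) + (y₁ * x₁t - p₂) - (y₂ * x₂t - p₃)) (x₂ * y₂t - p₄)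
    linarith
  have q₇ : |zt * ((P - Q) - e)| ≤ (u * |z|) * (u * (|P| + |Q|)) := by
    rw [abs_mul]; exact mul_le_mul hzt ee (abs_nonneg _) (by positivity)
  have q₈ : |zt * ((x₁ * y₁ - P) - (x₂ * y₂ - Q))| ≤ (u * |z|) * (u * |P| + u * |Q|) := by
    rw [abs_mul]
    refine mul_le_mul hzt ?_ (abs_nonneg _) (by positivity)
    linarith [abs_sub (x₁ * y₁ - P) (x₂ * y₂ - Q)]
  rw [key]
  have a1 := abs_sub (-((m + n) - t) - (z * d - m) - z * ((s₁ - s₂) - d)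
        - z * (((p₁ + p₂) - s₁) - ((p₃ + p₄) - s₂))
        - z * ((x₁ * y₁t - p₁) + (y₁ * x₁t - p₂) - (y₂ * x₂t - p₃) - (x₂ * y₂t - p₄))
        - (zt * e - n) - zt * ((P - Q) - e)) (zt * ((x₁ * y₁ - P) - (x₂ * y₂ - Q)))
  have a2 := abs_sub (-((m + n) - t) - (z * d - m) - z * ((s₁ - s₂) - d)
        - z * (((p₁ + p₂) - s₁) - ((p₃ + p₄) - s₂))
        - z * ((x₁ * y₁t - p₁) + (y₁ * x₁t - p₂) - (y₂ * x₂t - p₃) - (x₂ * y₂t - p₄))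
        - (zt * e - n)) (zt * ((P - Q) - e))
  have a3 := abs_sub (-((m + n) - t) - (z * d - m) - z * ((s₁ - s₂) - d)
        - z * (((p₁ + p₂) - s₁) - ((p₃ + p₄) - s₂))
        - z * ((x₁ * y₁t - p₁) + (y₁ * x₁t - p₂) - (y₂ * x₂t - p₃) - (x₂ * y₂t - p₄)))
        (zt * e - n)
  have a4 := abs_sub (-((m + n) - t) - (z * d - m) - z * ((s₁ - s₂) - d)
        - z * (((p₁ + p₂) - s₁) - ((p₃ + p₄) - s₂)))
        (z * ((x₁ * y₁t - p₁) + (y₁ * x₁t - p₂) - (y₂ * x₂t - p₃) - (x₂ * y₂t - p₄)))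
  have a5 := abs_sub (-((m + n) - t) - (z * d - m) - z * ((s₁ - s₂) - d))
        (z * (((p₁ + p₂) - s₁) - ((p₃ + p₄) - s₂)))
  have a6 := abs_sub (-((m + n) - t) - (z * d - m)) (z * ((s₁ - s₂) - d))
  have a7 := abs_sub (-((m + n) - t)) (z * d - m)
  rw [abs_neg] at a7
  linarith [a1, a2, a3, a4, a5, a6, a7, q₃, q₄, q₅, q₇, q₈, et, em, en]


/-- **The three terms summed**: `c = (t_a ⊕ t_b) ⊕ t_c` is within
`(20ε² + 66ε³ + 122ε⁴ + 145ε⁵ + 113ε⁶ + 56ε⁷ + 16ε⁸ + 2ε⁹)·Π` of `L = L_a + L_b + L_c`, where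
`Π = S_a + S_b + S_c`, `S_z = |z|(|P| + |Q|)`; and `|c| ≤ (1 + ε)²(3ε + 15ε² + …)·Π`. -/
theorem orient3dCSum_sub_le {u ta tb tc La Lb Lc Sa Sb Sc c₁ c : ℚ} (hu : 0 ≤ u) (hSc : 0 ≤ Sc)
    (ea : |ta - La| ≤ (14 * u ^ 2 + 33 * u ^ 3 + 41 * u ^ 4 + 30 * u ^ 5 + 12 * u ^ 6 + 2 * u ^ 7)
      * Sa) (ma : |ta| ≤ (3 * u + 15 * u ^ 2 + 33 * u ^ 3 + 41 * u ^ 4 + 30 * u ^ 5 + 12 * u ^ 6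
      + 2 * u ^ 7) * Sa)
    (eb : |tb - Lb| ≤ (14 * u ^ 2 + 33 * u ^ 3 + 41 * u ^ 4 + 30 * u ^ 5 + 12 * u ^ 6 + 2 * u ^ 7)
      * Sb) (mb : |tb| ≤ (3 * u + 15 * u ^ 2 + 33 * u ^ 3 + 41 * u ^ 4 + 30 * u ^ 5 + 12 * u ^ 6
      + 2 * u ^ 7) * Sb)
    (ec : |tc - Lc| ≤ (14 * u ^ 2 + 33 * u ^ 3 + 41 * u ^ 4 + 30 * u ^ 5 + 12 * u ^ 6 + 2 * u ^ 7)
      * Sc) (mc : |tc| ≤ (3 * u + 15 * u ^ 2 + 33 * u ^ 3 + 41 * u ^ 4 + 30 * u ^ 5 + 12 * u ^ 6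
      + 2 * u ^ 7) * Sc)
    (hc₁ : |(ta + tb) - c₁| ≤ u * |ta + tb|) (hc : |(c₁ + tc) - c| ≤ u * |c₁ + tc|) :
    |c - (La + Lb + Lc)| ≤ (20 * u ^ 2 + 66 * u ^ 3 + 122 * u ^ 4 + 145 * u ^ 5 + 113 * u ^ 6
        + 56 * u ^ 7 + 16 * u ^ 8 + 2 * u ^ 9) * (Sa + Sb + Sc) ∧
      |c| ≤ (1 + u) ^ 2 * (3 * u + 15 * u ^ 2 + 33 * u ^ 3 + 41 * u ^ 4 + 30 * u ^ 5
        + 12 * u ^ 6 + 2 * u ^ 7) * (Sa + Sb + Sc) := by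
  set M := 3 * u + 15 * u ^ 2 + 33 * u ^ 3 + 41 * u ^ 4 + 30 * u ^ 5 + 12 * u ^ 6 + 2 * u ^ 7
    with hM
  have b₁ : |ta + tb| ≤ M * Sa + M * Sb := by linarith [abs_add_le ta tb]
  have e₁ := rnd_err hu hc₁ b₁
  have m₁ := rnd_mag hu hc₁ b₁
  have b₂ : |c₁ + tc| ≤ (1 + u) * (M * Sa + M * Sb) + M * Sc := by linarith [abs_add_le c₁ tc]
  have e₂ := rnd_err hu hc b₂
  have m₂ := rnd_mag hu hc b₂
  constructor
  · have key : c - (La + Lb + Lc)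
        = -((c₁ + tc) - c) - ((ta + tb) - c₁) + (ta - La) + (tb - Lb) + (tc - Lc) := by ring
    rw [key]
    have a1 := abs_add_le (-((c₁ + tc) - c) - ((ta + tb) - c₁) + (ta - La) + (tb - Lb)) (tc - Lc)
    have a2 := abs_add_le (-((c₁ + tc) - c) - ((ta + tb) - c₁) + (ta - La)) (tb - Lb)
    have a3 := abs_add_le (-((c₁ + tc) - c) - ((ta + tb) - c₁)) (ta - La)
    have a4 := abs_sub (-((c₁ + tc) - c)) ((ta + tb) - c₁)
    rw [abs_neg] at a4
    rw [hM] at e₁ e₂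
    have hx : 0 ≤ u * ((3 * u + 15 * u ^ 2 + 33 * u ^ 3 + 41 * u ^ 4 + 30 * u ^ 5 + 12 * u ^ 6
        + 2 * u ^ 7) * Sc) := by positivity
    have hx' : 0 ≤ u * (u * ((3 * u + 15 * u ^ 2 + 33 * u ^ 3 + 41 * u ^ 4 + 30 * u ^ 5
        + 12 * u ^ 6 + 2 * u ^ 7) * Sc)) := by positivity
    linarith
  · rw [hM] at m₂
    have hx : 0 ≤ u * ((3 * u + 15 * u ^ 2 + 33 * u ^ 3 + 41 * u ^ 4 + 30 * u ^ 5 + 12 * u ^ 6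
        + 2 * u ^ 7) * Sc) := by positivity
    have hx' : 0 ≤ u * (u * ((3 * u + 15 * u ^ 2 + 33 * u ^ 3 + 41 * u ^ 4 + 30 * u ^ 5
        + 12 * u ^ 6 + 2 * u ^ 7) * Sc)) := by positivity
    linarith

/-! ## The second- and third-order remainder -/

/-- **The remainder of one cyclic term**: the true term
`(z + zt)((x₁ + x₁t)(y₁ + y₁t) − (x₂ + x₂t)(y₂ + y₂t))` minus its zeroth-order part
`z(x₁y₁ − x₂y₂)` minus its first-order part `L_z` is at most `(3ε² + ε³)(1 + ε)·|z|(|P| + |Q|)`. -/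
theorem orient3dCRemainder_le {u z zt x₁ x₁t y₁ y₁t x₂ x₂t y₂ y₂t P Q : ℚ} (hu : 0 ≤ u)
    (hzt : |zt| ≤ u * |z|) (hx₁t : |x₁t| ≤ u * |x₁|) (hy₁t : |y₁t| ≤ u * |y₁|)
    (hx₂t : |x₂t| ≤ u * |x₂|) (hy₂t : |y₂t| ≤ u * |y₂|)
    (hP : |x₁ * y₁ - P| ≤ u * |P|) (hQ : |x₂ * y₂ - Q| ≤ u * |Q|) :
    |(z + zt) * ((x₁ + x₁t) * (y₁ + y₁t) - (x₂ + x₂t) * (y₂ + y₂t)) - z * (x₁ * y₁ - x₂ * y₂)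
        - (z * ((x₁ * y₁t + y₁ * x₁t) - (y₂ * x₂t + x₂ * y₂t)) + zt * (x₁ * y₁ - y₂ * x₂))|
      ≤ (3 * u ^ 2 + u ^ 3) * (1 + u) * (|z| * (|P| + |Q|)) := by
  have hz := abs_nonneg z
  have hP' : |x₁ * y₁| ≤ (1 + u) * |P| := by linarith [abs_sub_abs_le_abs_sub (x₁ * y₁) P]
  have hQ' : |x₂ * y₂| ≤ (1 + u) * |Q| := by linarith [abs_sub_abs_le_abs_sub (x₂ * y₂) Q]
  have key : (z + zt) * ((x₁ + x₁t) * (y₁ + y₁t) - (x₂ + x₂t) * (y₂ + y₂t))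
      - z * (x₁ * y₁ - x₂ * y₂)
      - (z * ((x₁ * y₁t + y₁ * x₁t) - (y₂ * x₂t + x₂ * y₂t)) + zt * (x₁ * y₁ - y₂ * x₂))
      = z * (x₁t * y₁t - x₂t * y₂t)
        + zt * ((x₁ * y₁t + x₁t * y₁ + x₁t * y₁t) - (x₂ * y₂t + x₂t * y₂ + x₂t * y₂t)) := by
    ring
  -- second-order products of tails
  have tt₁ : |x₁t * y₁t| ≤ u ^ 2 * |x₁ * y₁| := by
    rw [abs_mul, abs_mul]
    calc |x₁t| * |y₁t| ≤ (u * |x₁|) * (u * |y₁|) :=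
          mul_le_mul hx₁t hy₁t (abs_nonneg _) (by positivity)
      _ = u ^ 2 * (|x₁| * |y₁|) := by ring
  have tt₂ : |x₂t * y₂t| ≤ u ^ 2 * |x₂ * y₂| := by
    rw [abs_mul, abs_mul]
    calc |x₂t| * |y₂t| ≤ (u * |x₂|) * (u * |y₂|) :=
          mul_le_mul hx₂t hy₂t (abs_nonneg _) (by positivity)
      _ = u ^ 2 * (|x₂| * |y₂|) := by ring
  -- first-order products
  have f₁ : |x₁ * y₁t| ≤ u * |x₁ * y₁| := abs_mul_tail_le hy₁t
  have f₂ : |x₁t * y₁| ≤ u * |x₁ * y₁| := by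
    have h := abs_mul_tail_le (x := y₁) hx₁t
    rwa [mul_comm y₁ x₁t, mul_comm y₁ x₁] at h
  have f₃ : |x₂ * y₂t| ≤ u * |x₂ * y₂| := abs_mul_tail_le hy₂t
  have f₄ : |x₂t * y₂| ≤ u * |x₂ * y₂| := by
    have h := abs_mul_tail_le (x := y₂) hx₂t
    rwa [mul_comm y₂ x₂t, mul_comm y₂ x₂] at h
  have i₁ : |x₁t * y₁t - x₂t * y₂t| ≤ u ^ 2 * |x₁ * y₁| + u ^ 2 * |x₂ * y₂| := by
    linarith [abs_sub (x₁t * y₁t) (x₂t * y₂t)]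
  have i₂ : |(x₁ * y₁t + x₁t * y₁ + x₁t * y₁t) - (x₂ * y₂t + x₂t * y₂ + x₂t * y₂t)|
      ≤ (2 * u + u ^ 2) * (|x₁ * y₁| + |x₂ * y₂|) := by
    have a1 := abs_sub (x₁ * y₁t + x₁t * y₁ + x₁t * y₁t) (x₂ * y₂t + x₂t * y₂ + x₂t * y₂t)
    have a2 := abs_add_le (x₁ * y₁t + x₁t * y₁) (x₁t * y₁t)
    have a3 := abs_add_le (x₁ * y₁t) (x₁t * y₁)
    have a4 := abs_add_le (x₂ * y₂t + x₂t * y₂) (x₂t * y₂t)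
    have a5 := abs_add_le (x₂ * y₂t) (x₂t * y₂)
    linarith
  have j₁ : |z * (x₁t * y₁t - x₂t * y₂t)| ≤ |z| * (u ^ 2 * |x₁ * y₁| + u ^ 2 * |x₂ * y₂|) := by
    rw [abs_mul]; exact mul_le_mul_of_nonneg_left i₁ hz
  have j₂ : |zt * ((x₁ * y₁t + x₁t * y₁ + x₁t * y₁t) - (x₂ * y₂t + x₂t * y₂ + x₂t * y₂t))|
      ≤ (u * |z|) * ((2 * u + u ^ 2) * (|x₁ * y₁| + |x₂ * y₂|)) := by
    rw [abs_mul]; exact mul_le_mul hzt i₂ (abs_nonneg _) (by positivity)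
  rw [key]
  have a := abs_add_le (z * (x₁t * y₁t - x₂t * y₂t))
    (zt * ((x₁ * y₁t + x₁t * y₁ + x₁t * y₁t) - (x₂ * y₂t + x₂t * y₂ + x₂t * y₂t)))
  have k₁ : |z| * |x₁ * y₁| ≤ |z| * ((1 + u) * |P|) := mul_le_mul_of_nonneg_left hP' hz
  have k₂ : |z| * |x₂ * y₂| ≤ |z| * ((1 + u) * |Q|) := mul_le_mul_of_nonneg_left hQ' hz
  have c₀ : 0 ≤ 3 * u ^ 2 + u ^ 3 := by positivity
  have k₃ := mul_le_mul_of_nonneg_left (add_le_add k₁ k₂) c₀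
  linarith

end Summit.Ventures.CertifiedArithmetic.Expansions
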